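import Summits.BirchSwinnertonDyer.BirchSwinnertonDyer.Theorems.SylvesterTwoHeegnerIndexCMHalfDecompositionAtThree
import Literature.NumberTheory.EllipticCurves.RingClassFieldConjugation
import Literature.NumberTheory.EllipticCurves.SelmerGaloisAction
import HarnessLib

/-!
# The COUPLED Cassels–Tate telescope, RESIDUE 7′ (VARIANT Q): the HALF FIXER `N″` IS NORMAL in `Γ_K` and STABLE under
# conjugation by a lift of complex conjugation (crux `UpperOffV0HSYPlus`, stmt-BirchSwinnertonDyer-19804)

Skeleton VARIANT Q `Cruxes/UpperOffV0HSYPlus/Lines/coupled_variantQ.lean` d342db51dc602551, stub `stub_residueSevenHalved`;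
planner D801 (3) («the RESIDUE 7′ assembler against g31's shape»).  The (B) SIGNS layer of RESIDUE 4 (g31's (F★)
`exists_reflection_chiComponent` / B-IV) is stated for an ABSTRACT coset subgroup `N₀ ⊴ Γ_K` with `τ̃ N₀ τ̃ = N₀` and a
transversal `t` of `Γ_K/N₀`; on the HALVED classes it is applied with `N₀ := N″`, the fixer of `K[9p]^{⟨s⟩}` (CMHalf #S3
`exists_halfFixer`: `N₀ ≤ N″`, the dichotomy «`g ∈ N″` acts on `emb₀ K[9p]` as `1` or as `s`», every lift of `s` lies in
`N″`), and the half family as transversal.  This file supplies the two group-theoretic inputs that instantiation needs: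
* `halfFixer_normal` — `N″ ⊴ Γ_K`: `Gal(K[9p]/K)` is abelian (`isAbelianGalois_ringClassField`), so a conjugate of an
  element acting as `1`/`s` on `emb₀ K[9p]` acts as `1`/`s` again (restriction `exists_restrictHom`).
* `conjGalCMH_mem_halfFixer` — `τ̃ h τ̃ ∈ N″` for `h ∈ N″` and `τ̃` a lift of the conjugation `c` of `K` restricting to
  `τ₀ ∉ 𝒢` on `emb₀ K[9p]`: `τ₀ s τ₀⁻¹ = s⁻¹ = s` (Cox Lemma 9.3 / Gross §5, tree
  `mul_mul_inv_eq_inv_of_not_mem_ringClassGal`), so the conjugate acts as `1` or as `s`.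
Theorems only (no definition / named fact / instance / notation); pure Galois bookkeeping (no points, no `Ш`); nothing
asserted on 19804; no stub closed on the ledger; X12.CMAtTwo NOT proved; BSD not claimed for any curve.  Sources:
[GrossLMS1991] §3 (p. 238), §5 (τστ⁻¹ = σ⁻¹); [Cox2013] Lemma 9.3; [HuShuYin2019] §2 Prop. 2.4.
`lean search 'halfFixer_normal|conjGalCMH_mem_halfFixer'` → nothing before this file.
-/

set_option linter.dupNamespace false -- Summits modules are `Summit.<Summit>.<Problem>…` by design
set_option autoImplicit false

noncomputable section

open scoped Classical

namespace Summit.BirchSwinnertonDyer.BirchSwinnertonDyer.Theorems.SylvesterTwoCMHalf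

open Field NumberField
open Literature.NumberTheory.EllipticCurves Literature.NumberTheory.GaloisRepresentations
  Literature.NumberTheory.EllipticCurves.RingClassField
  Summit.BirchSwinnertonDyer.Rank1Residual.X11b Summit.BirchSwinnertonDyer.Rank1Residual.X11b.RingClassTower

variable {K : Type} [Field K] [NumberField K]

/-- **The half fixer is normal**: with `N₀` the fixer of `emb₀ K[m]`, `N₀ ≤ N″`, the dichotomy for `N″` w.r.t. a
`K`-automorphism `s` of `K[m]`, and every lift of `s` in `N″`, the subgroup `N″` is normal in `Γ_K` (`Gal(K[m]/K)` is
abelian). [cite: GrossLMS1991, §3 (p. 238: 𝒢_n abelian)] [cite: Cox2013, §9.A] -/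
theorem halfFixer_normal (hK : IsImaginaryQuadratic K) (ι : K →+* ℂ) {m : ℕ} (hm0 : m ≠ 0)
    (emb₀ : ringClassField K ι m →+* AlgebraicClosure K)
    (hemb₀ : ∀ k : K, emb₀ (algebraMap K (ringClassField K ι m) k) = algebraMap K (AlgebraicClosure K) k)
    {N₀ N'' : Subgroup (absoluteGaloisGroup K)}
    (hN₀ : ∀ g : absoluteGaloisGroup K, g ∈ N₀ ↔
      ∀ x : ringClassField K ι m, (show AlgebraicClosure K ≃ₐ[K] AlgebraicClosure K from g) (emb₀ x) = emb₀ x)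
    {s : ringClassField K ι m ≃ₐ[K] ringClassField K ι m} (hN''₀ : ∀ g ∈ N₀, g ∈ N'')
    (hdich : ∀ g ∈ N'', (∀ x : ringClassField K ι m,
        (show AlgebraicClosure K ≃ₐ[K] AlgebraicClosure K from g) (emb₀ x) = emb₀ x) ∨
      (∀ x : ringClassField K ι m,
        (show AlgebraicClosure K ≃ₐ[K] AlgebraicClosure K from g) (emb₀ x) = emb₀ (s x)))
    (hlift : ∀ g : absoluteGaloisGroup K, (∀ x : ringClassField K ι m,
        (show AlgebraicClosure K ≃ₐ[K] AlgebraicClosure K from g) (emb₀ x) = emb₀ (s x)) → g ∈ N'') :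
    N''.Normal := by
  haveI := (finiteDimensional_and_isGalois_ringClassField hK ι hm0).1
  haveI := (finiteDimensional_and_isGalois_ringClassField hK ι hm0).2
  haveI := isAbelianGalois_ringClassField hK ι hm0
  obtain ⟨r, hr, -, -⟩ := exists_restrictHom hK ι hm0 emb₀ hemb₀
  -- the action of `k g k⁻¹` on `emb₀ x` is that of `g` (abelian restriction)
  have hconj : ∀ (g k : absoluteGaloisGroup K) (x : ringClassField K ι m),
      (show AlgebraicClosure K ≃ₐ[K] AlgebraicClosure K from k * g * k⁻¹) (emb₀ x) = emb₀ (r g x) := by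
    intro g k x
    rw [hr, map_mul, map_mul, map_inv]
    have hc : r k * r g * (r k)⁻¹ = r g := by
      rw [show r k * r g = r g * r k from IsMulCommutative.is_comm.comm _ _, mul_inv_cancel_right]
    rw [hc]
  refine ⟨fun g hg k ↦ ?_⟩
  rcases hdich g hg with h1 | hs
  · refine hN''₀ _ ((hN₀ _).mpr fun x ↦ ?_)
    rw [hconj, ← hr, h1]
  · refine hlift _ fun x ↦ ?_
    rw [hconj, ← hr, hs]

/-- **The half fixer is stable under a lift of complex conjugation**: for `τ̃` lifting the conjugation `c` of `K` and
restricting on `emb₀ K[m]` to some `τ₀ ∉ 𝒢 = Gal(K[m]/K)`, and `s ∈ 𝒢` (qua `ℚ`-automorphism) with `s² = 1`: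
`τ̃ h τ̃ ∈ N″` for every `h ∈ N″` — because `τ₀ s τ₀⁻¹ = s⁻¹ = s`.
[cite: GrossLMS1991, §5 (τ σ τ⁻¹ = σ⁻¹)] [cite: Cox2013, Lemma 9.3] -/
theorem conjGalCMH_mem_halfFixer (hK : IsImaginaryQuadratic K) (ι : K →+* ℂ) {m : ℕ} (hm0 : m ≠ 0)
    {c : K ≃ₐ[ℚ] K} {τ : AlgebraicClosure K ≃+* AlgebraicClosure K} (hτ : IsLiftOfAut c τ)
    (emb₀ : ringClassField K ι m →+* AlgebraicClosure K)
    {N₀ N'' : Subgroup (absoluteGaloisGroup K)}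
    (hN₀ : ∀ g : absoluteGaloisGroup K, g ∈ N₀ ↔
      ∀ x : ringClassField K ι m, (show AlgebraicClosure K ≃ₐ[K] AlgebraicClosure K from g) (emb₀ x) = emb₀ x)
    {s : ringClassField K ι m ≃ₐ[K] ringClassField K ι m} (hs2 : s * s = 1) (hN''₀ : ∀ g ∈ N₀, g ∈ N'')
    (hdich : ∀ g ∈ N'', (∀ x : ringClassField K ι m,
        (show AlgebraicClosure K ≃ₐ[K] AlgebraicClosure K from g) (emb₀ x) = emb₀ x) ∨
      (∀ x : ringClassField K ι m,
        (show AlgebraicClosure K ≃ₐ[K] AlgebraicClosure K from g) (emb₀ x) = emb₀ (s x)))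
    (hlift : ∀ g : absoluteGaloisGroup K, (∀ x : ringClassField K ι m,
        (show AlgebraicClosure K ≃ₐ[K] AlgebraicClosure K from g) (emb₀ x) = emb₀ (s x)) → g ∈ N'')
    {τ₀ : ringClassField K ι m ≃ₐ[ℚ] ringClassField K ι m}
    (hτ₀c : ∀ x : ringClassField K ι m, τ (emb₀ x) = emb₀ (τ₀ x)) (hτ₀ : τ₀ ∉ ringClassGal ι m)
    {h : absoluteGaloisGroup K} (hh : h ∈ N'') : hτ.conjGalCMH h ∈ N'' := by
  -- `s` as a `ℚ`-automorphism lies in `𝒢`, is an involution, and commutes with `τ₀` (dihedral relation)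
  have hsG : s.restrictScalars ℚ ∈ ringClassGal ι m :=
    (mem_ringClassGal_iff_forall_apply_algebraMap ι _ _).mpr fun k ↦ s.commutes k
  have hsinv : (s.restrictScalars ℚ)⁻¹ = s.restrictScalars ℚ := by
    refine inv_eq_of_mul_eq_one_right (AlgEquiv.ext fun x ↦ ?_)
    change s (s x) = x
    rw [← AlgEquiv.mul_apply, hs2, AlgEquiv.one_apply]
  have hcomm : ∀ x, τ₀ (s x) = s (τ₀ x) := by
    intro x
    have e := mul_mul_inv_eq_inv_of_not_mem_ringClassGal hK ι hm0 hτ₀ hsG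
    rw [hsinv, mul_inv_eq_iff_eq_mul] at e
    have ex := congrArg (fun f ↦ f x) e
    simp only [AlgEquiv.mul_apply] at ex
    exact ex
  rcases hdich h hh with h1 | hs
  · refine hN''₀ _ ((hN₀ _).mpr fun x ↦ ?_)
    change τ.symm ((show AlgebraicClosure K ≃ₐ[K] AlgebraicClosure K from h) (τ (emb₀ x))) = emb₀ x
    rw [hτ₀c, h1, ← hτ₀c, RingEquiv.symm_apply_apply]
  · refine hlift _ fun x ↦ ?_
    change τ.symm ((show AlgebraicClosure K ≃ₐ[K] AlgebraicClosure K from h) (τ (emb₀ x))) = emb₀ (s x)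
    rw [hτ₀c, hs, ← hcomm, ← hτ₀c, RingEquiv.symm_apply_apply]

end Summit.BirchSwinnertonDyer.BirchSwinnertonDyer.Theorems.SylvesterTwoCMHalf

end
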